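import Literature.AlgebraicGeometry.Frobenioids.IsometricPreStepsPullback
import HarnessLib

/-!
# Frobenioids I, Proposition 1.11 (Pull-back and Linear Morphisms), parts (i)–(iv), (vi);
# Remark 1.11.1

Mochizuki, *The geometry of Frobenioids I: the general theory*, Kyushu J. Math. **62** (2008)
293–400, §1, Proposition 1.11 (i)–(iv), (vi), Remark 1.11.1 and their proofs, kurims text
pp. 36–39 [cite: MochizukiFrdI2008, Prop. 1.11]. Standing data: `C → F_Φ` a Frobenioid (`hF`).

> "(i) Suppose further that `C` is of Aut-ample and base-trivial type. Then the natural
> projection functor `C^pl-bk → D` is full. (ii) Suppose further that `C` is of unit-trivial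
> type. Then the natural projection functor `C^pl-bk → D` is faithful. (iii) Let `φ : B → A` be a
> pull-back morphism that projects to a morphism `φ_D = Base(φ) : B_D → A_D` of `D`. Then given
> any `α ∈ End_C(A)`, `β_D ∈ End_D(B_D)` such that `Base(α) ∘ φ_D = φ_D ∘ β_D`, there exists a
> unique `β ∈ End_C(B)` such that `Base(β) = β_D`, `α ∘ φ = φ ∘ β`. (iv) Every co-angular linear
> morphism `φ : B → A` determines an injection of monoids `O^▷(A) ↪ O^▷(B)` which is uniquely
> determined by the condition that `O^▷(A) ∋ α ↦ β ∈ O^▷(B)` implies `α ∘ φ = φ ∘ β`. …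
> (vi) A pull-back morphism `φ ∈ Arr(C)` is an FSM-morphism (respectively, fiberwise-surjective
> morphism; monomorphism; irreducible morphism) if and only if `Base(φ) ∈ Arr(D)` is.
> Remark 1.11.1. Observe that in the situation of Proposition 1.11, (iii), if `α` is a morphism
> of Frobenius type, and `β_D` is an isomorphism, then `β` is a morphism of Frobenius type. … In
> particular, it follows [cf. Remark 1.2.1] that [at least in the case of Frobenioids]
> 'Frobenius-trivial' implies 'universally Div-Frobenius-trivial'."

Everything here is PROVED along the printed proofs (p. 37 for (i)–(iv), p. 38 for (vi) and
Remark 1.11.1). Parts (v) and (vii) are in the companion files `PullbackLinearSquares.lean` and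
`CoAngularPreSteps.lean`.

Renderings (recorded for the referee). Composition is diagrammatic (`φ ≫ α = β ≫ φ` is the
text's `α ∘ φ = φ ∘ β`). `C^pl-bk → D` is `wideSubcategoryInclusion (pullbackMorphisms F) ⋙
baseFunctor F`. (iv) is rendered as: for each `α ∈ O^▷(A)` the `β ∈ O^▷(B)` with `α ∘ φ = φ ∘ β`
exists uniquely, and `α ↦ β` is an injective monoid homomorphism. No statement of the paper is
strengthened.
-/

namespace Literature.AlgebraicGeometry.Frobenioids

open CategoryTheory Opposite

universe w v v' u u'

namespace PreFrobenioid

variable {D : Type u} [Category.{v} D] {Φ : Dᵒᵖ ⥤ CommMonCat.{w}}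
  {C : Type u'} [Category.{v'} C] {F : C ⥤ ElemFrobenioid Φ}

/-! ### Proposition 1.11 (i), (ii) -/

/-- **Prop. 1.11 (i)**: if `C` is of `Aut`-ample and base-trivial type then `C^pl-bk → D` is full
(a pull-back morphism over a given arrow exists by Def. 1.3 (i)(c); its domain is isomorphic to
`A` by base-triviality; the discrepancy in `Aut_D(A_D)` lifts by `Aut`-ampleness).
[cite: MochizukiFrdI2008, Prop. 1.11(i) p.36] -/
theorem pullbackCat_baseFunctor_full (hF : IsFrobenioid F) (haut : IsOfType (IsAutAmple F))
    (hbt : IsOfType (IsBaseTrivial F)) :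
    (wideSubcategoryInclusion (pullbackMorphisms F) ⋙ baseFunctor F).Full := by
  refine ⟨fun {A B} f => ?_⟩
  change baseObj F A.obj ⟶ baseObj F B.obj at f
  -- a pull-back morphism `ψ : X → B` over `f`, up to `i : X_D ≅ A_D`
  obtain ⟨X, ψ, i, hψ, hψb⟩ := exists_isPullbackMorphism_over hF B.obj f
  -- `X ≅ A` by base-triviality
  obtain ⟨e⟩ := hbt A.obj X ⟨i.symm⟩
  -- the automorphism of `A_D` measuring the discrepancy lifts to `A` by `Aut`-ampleness
  haveI : IsIso (Base F e.inv) := isBaseIso_of_isIso F e.inv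
  obtain ⟨γ, hγ⟩ := haut A.obj ((asIso (Base F e.inv) ≪≫ i).symm)
  have hγ' : Base F γ.hom = (asIso (Base F e.inv) ≪≫ i).inv := congrArg Iso.hom hγ
  refine ⟨⟨γ.hom ≫ e.inv ≫ ψ, IsPullbackMorphism.comp F (isPullbackMorphism_of_isIso F γ.hom)
    (IsPullbackMorphism.comp F (isPullbackMorphism_of_isIso F e.inv) hψ)⟩, ?_⟩
  show Base F (γ.hom ≫ e.inv ≫ ψ) = f
  rw [base_comp, base_comp, hγ', hψb, Iso.trans_inv, asIso_inv, Category.assoc,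
    IsIso.inv_hom_id_assoc, i.inv_hom_id_assoc]

/-- **Prop. 1.11 (ii)**: if `C` is of unit-trivial type then `C^pl-bk → D` is faithful (two
pull-back morphisms over the same arrow differ by base-identity endomorphisms of the domain, which
are mutually inverse, hence units of `O^×`, hence trivial).
[cite: MochizukiFrdI2008, Prop. 1.11(ii) p.36] -/
theorem pullbackCat_baseFunctor_faithful (hF : IsFrobenioid F) (hut : IsOfType (IsUnitTrivial F)) :
    (wideSubcategoryInclusion (pullbackMorphisms F) ⋙ baseFunctor F).Faithful := by
  refine ⟨fun {A B} φ ψ h => ?_⟩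
  have hb : Base F φ.1 = Base F ψ.1 := h
  obtain ⟨α, hα, hαb⟩ := IsPullbackMorphism.exists_lift φ.2 ψ.1 (𝟙 _)
    (by rw [Category.id_comp, hb])
  obtain ⟨β, hβ, hβb⟩ := IsPullbackMorphism.exists_lift ψ.2 φ.1 (𝟙 _)
    (by rw [Category.id_comp, hb])
  have h1 : β ≫ α = 𝟙 _ := IsPullbackMorphism.hom_ext φ.2
    (by rw [Category.assoc, hα, hβ, Category.id_comp])
    (by rw [base_comp, hαb, hβb, Category.id_comp, base_id])
  have h2 : α ≫ β = 𝟙 _ := IsPullbackMorphism.hom_ext ψ.2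
    (by rw [Category.assoc, hβ, hα, Category.id_comp])
    (by rw [base_comp, hαb, hβb, Category.id_comp, base_id])
  -- `α` is linear: `α ≫ φ = ψ` with `φ`, `ψ` linear (pull-back morphisms, Def. 1.3 (iv)(b))
  have hαlin : IsLinear F α := by
    have hlin : IsLinear F (α ≫ φ.1) := by rw [hα]; exact (hF.iv_b ψ.1 ψ.2).2
    exact (isLinear_factors F hlin).2
  let a : Aut A.obj := ⟨α, β, h2, h1⟩
  have ha : a ∈ unitsSubgroup F A.obj := ⟨hαb, hαlin⟩
  have ha1 : a = 1 := hut A.obj a ha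
  have hα1 : α = 𝟙 _ := congrArg Iso.hom ha1
  apply InducedWideCategory.Hom.ext
  show φ.1 = ψ.1
  rw [← hα, hα1, Category.id_comp]

/-! ### Proposition 1.11 (iii) -/

/-- **Prop. 1.11 (iii)**: endomorphisms of `A` lift uniquely along a pull-back morphism
`φ : B → A` once their projections do ("immediately from the isomorphism of functors appearing in
the definition of a pull-back morphism"). [cite: MochizukiFrdI2008, Prop. 1.11(iii) p.36] -/
theorem existsUnique_endo_lift {A B : C} {φ : B ⟶ A} (hφ : IsPullbackMorphism F φ) (α : A ⟶ A)
    (βD : baseObj F B ⟶ baseObj F B) (h : Base F φ ≫ Base F α = βD ≫ Base F φ) :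
    ∃! β : B ⟶ B, Base F β = βD ∧ φ ≫ α = β ≫ φ := by
  obtain ⟨β, hβ, hβb⟩ := hφ.exists_lift (φ ≫ α) βD (by rw [base_comp, h])
  refine ⟨β, ⟨hβb, hβ.symm⟩, fun β' hβ' => ?_⟩
  exact hφ.hom_ext (by rw [hβ, hβ'.2]) (by rw [hβb, hβ'.1])

/-! ### Remark 1.11.1 -/

/-- **Remark 1.11.1**: in the situation of (iii), if `α` is of Frobenius type and `β_D` is an
isomorphism then `β` is of Frobenius type ("`β` is co-angular by Definition 1.3, (iii), (b), and
isometric by Remark 1.1.1"). [cite: MochizukiFrdI2008, Rem. 1.11.1 p.38] -/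
theorem isFrobeniusType_endo_lift (hF : IsFrobenioid F) {A B : C} {φ : B ⟶ A}
    (hφ : IsPullbackMorphism F φ) {α : A ⟶ A} (hα : IsFrobeniusType F α) {β : B ⟶ B}
    (hsq : φ ≫ α = β ≫ φ) (hβb : IsIso (Base F β)) : IsFrobeniusType F β := by
  obtain ⟨⟨-, hφiso⟩, hφlin⟩ := hF.iv_b φ hφ
  refine ⟨⟨isCoAngular_endo F hF β, ?_⟩, hβb⟩
  have hd := congrArg (Div F) hsq
  rw [div_comp, div_comp, show Div F α = 1 from hα.1.2, map_one, one_mul,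
    show Div F φ = 1 from hφiso, one_pow, map_one, one_mul, show degFr F φ = 1 from hφlin,
    PNat.one_coe, pow_one] at hd
  exact hd.symm

/-- **Remark 1.11.1**, "In particular": in a Frobenioid a Frobenius-trivial object is universally
`Div`-Frobenius-trivial (lift `ζ_A(n)` along any pull-back morphism `B → A` by (iii) with
`β_D = id`; the lifts are of Frobenius type by the Remark, base-identity hence `Div`-identity
[Remark 1.2.1], and form a homomorphism by uniqueness). [cite: MochizukiFrdI2008, Rem. 1.11.1 p.39] -/
theorem IsFrobeniusTrivial.isUniversallyDivFrobeniusTrivial (hF : IsFrobenioid F) {A : C}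
    (hA : IsFrobeniusTrivial F A) : IsUniversallyDivFrobeniusTrivial F A := by
  intro B φ hφ
  obtain ⟨ζ, hζ⟩ := hA
  -- the unique base-identity lift of `ζ n` along `φ`
  have hex : ∀ n : ℕ+, ∃! β : B ⟶ B, Base F β = 𝟙 _ ∧ φ ≫ (ζ n : A ⟶ A) = β ≫ φ := fun n =>
    existsUnique_endo_lift hφ (ζ n) (𝟙 _)
      (by rw [show Base F (ζ n : A ⟶ A) = 𝟙 _ from (hζ n).2.1, Category.comp_id, Category.id_comp])
  choose β hβ hβu using hex
  have hβ1 : β 1 = 𝟙 B := by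
    symm
    apply hβu 1
    refine ⟨base_id F B, ?_⟩
    rw [map_one, Category.id_comp]
    exact Category.comp_id φ
  have hβmul : ∀ m n, β (m * n) = β n ≫ β m := by
    intro m n
    symm
    apply hβu (m * n)
    refine ⟨by rw [base_comp, (hβ n).1, (hβ m).1, Category.id_comp], ?_⟩
    rw [map_mul, End.mul_def, ← Category.assoc, (hβ n).2, Category.assoc, (hβ m).2, Category.assoc]
  let ζ' : ℕ+ →* End B :=
    { toFun := fun n => β n
      map_one' := hβ1
      map_mul' := fun m n => hβmul m n }
  refine ⟨ζ', fun n => ⟨?_, (hβ n).1 |> fun h => ?_, ?_⟩⟩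
  · -- degree
    have hd := congrArg (degFr F) (hβ n).2
    rw [degFr_comp, degFr_comp, (hζ n).1, (hF.iv_b φ hφ).2, one_mul, mul_one] at hd
    exact hd.symm
  · -- `Div`-identity (from base-identity, Remark 1.2.1)
    exact IsBaseIdentity.isDivIdentity F h
  · -- Frobenius type (Remark 1.11.1)
    exact isFrobeniusType_endo_lift hF hφ (hζ n).2.2 (hβ n).2
      (by show IsIso (Base F (β n)); rw [show Base F (β n) = 𝟙 _ from (hβ n).1]; infer_instance)

/-! ### Proposition 1.11 (iv) -/

/-- **Prop. 1.11 (iv)**, uniqueness: for a co-angular linear `φ : B → A` and `α ∈ O^▷(A)` there is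
at most one `β ∈ O^▷(B)` with `α ∘ φ = φ ∘ β` (factor `φ` as pull-back ∘ co-angular pre-step;
pre-steps are monomorphisms and pull-back morphisms are injective on compatible data).
[cite: MochizukiFrdI2008, Prop. 1.11(iv) p.36] -/
theorem endSubmonoid_intertwiner_unique (hF : IsFrobenioid F) {A B : C} {φ : B ⟶ A}
    (hlin : IsLinear F φ) {α : A ⟶ A} {β β' : endSubmonoid F B}
    (h : φ ≫ α = (β.1 : B ⟶ B) ≫ φ) (h' : φ ≫ α = (β'.1 : B ⟶ B) ≫ φ) : β = β' := by
  -- `φ = p ≫ q` with `p` a pre-step and `q` a pull-back morphism (Prop. 1.7 (iii))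
  obtain ⟨X, p, q, hfac, hp, hq⟩ := (isLinear_iff_exists_preStep_pullback F hF φ).mp hlin
  haveI := hF.v_a p hp
  have key : (β.1 : B ⟶ B) ≫ p = (β'.1 : B ⟶ B) ≫ p := by
    apply hq.hom_ext
    · rw [Category.assoc, Category.assoc, hfac, ← h, ← h']
    · rw [base_comp, base_comp, show Base F (β.1 : B ⟶ B) = 𝟙 _ from β.2.1,
        show Base F (β'.1 : B ⟶ B) = 𝟙 _ from β'.2.1]
  exact Subtype.ext ((cancel_mono p).mp key)

/-- **Prop. 1.11 (iv)**, existence: for a co-angular linear `φ : B → A` and `α ∈ O^▷(A)` there is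
`β ∈ O^▷(B)` with `α ∘ φ = φ ∘ β` (factor `φ = q ∘ p`; lift `α` along the pull-back `q` by (iii),
then transport along the co-angular pre-step `p` by Def. 1.3 (iii)(c)).
[cite: MochizukiFrdI2008, Prop. 1.11(iv) p.36] -/
theorem exists_endSubmonoid_intertwiner (hF : IsFrobenioid F) {A B : C} {φ : B ⟶ A}
    (hco : IsCoAngular F φ) (hlin : IsLinear F φ) (α : endSubmonoid F A) :
    ∃ β : endSubmonoid F B, φ ≫ (α.1 : A ⟶ A) = (β.1 : B ⟶ B) ≫ φ := by
  have hC := hF.isPreFrobenioid.isTotallyEpimorphic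
  obtain ⟨X, p, q, hfac, hp, hq⟩ := (isLinear_iff_exists_preStep_pullback F hF φ).mp hlin
  -- `p` is co-angular (Prop. 1.4 (iv) with trivial Frobenius-type part)
  have hpco : IsCoAngular F p :=
    (isCoAngular_iff_of_factorization F hF φ (𝟙 B) p q (by rw [Category.id_comp, hfac])
      (isFrobeniusType_of_isIso F hF.isPreFrobenioid (𝟙 B)) hp hq).mp hco
  -- lift `α` along `q`
  obtain ⟨x, ⟨hxb, hx⟩, -⟩ := existsUnique_endo_lift hq (α.1 : A ⟶ A) (𝟙 _)
    (by rw [show Base F (α.1 : A ⟶ A) = 𝟙 _ from α.2.1, Category.comp_id, Category.id_comp])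
  have hxlin : IsLinear F x := by
    have hd := congrArg (degFr F) hx
    rw [degFr_comp, degFr_comp, show degFr F (α.1 : A ⟶ A) = 1 from α.2.2, (hF.iv_b q hq).2] at hd
    show degFr F x = 1
    simpa using hd.symm
  -- transport along the co-angular pre-step `p`
  obtain ⟨e, he⟩ := hF.iii_c p ⟨hpco, hp⟩
  let x' : endSubmonoid F X := ⟨x, hxb, hxlin⟩
  refine ⟨e.symm x', ?_⟩
  have h1 := he (e.symm x')
  rw [MulEquiv.apply_symm_apply] at h1
  -- h1 : p ≫ x = (e.symm x') ≫ p
  rw [← hfac, Category.assoc, hx]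
  show p ≫ x ≫ q = _
  rw [← Category.assoc]
  erw [h1]
  rw [Category.assoc]

/-- **Prop. 1.11 (iv)**: a co-angular linear `φ : B → A` determines an injective homomorphism of
monoids `O^▷(A) ↪ O^▷(B)`, `α ↦ β`, characterised by `α ∘ φ = φ ∘ β` (injectivity by the total
epimorphicity of `C`). [cite: MochizukiFrdI2008, Prop. 1.11(iv) p.36] -/
theorem exists_endSubmonoid_hom (hF : IsFrobenioid F) {A B : C} {φ : B ⟶ A}
    (hco : IsCoAngular F φ) (hlin : IsLinear F φ) :
    ∃ ρ : endSubmonoid F A →* endSubmonoid F B, Function.Injective ρ ∧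
      ∀ α : endSubmonoid F A, φ ≫ (α.1 : A ⟶ A) = ((ρ α).1 : B ⟶ B) ≫ φ := by
  have hC := hF.isPreFrobenioid.isTotallyEpimorphic
  choose ρ hρ using fun α => exists_endSubmonoid_intertwiner hF hco hlin α
  have hρ1 : ρ 1 = 1 := endSubmonoid_intertwiner_unique hF hlin (hρ 1)
    (by rw [OneMemClass.coe_one, OneMemClass.coe_one, End.one_def, End.one_def,
      Category.id_comp, Category.comp_id])
  have hρmul : ∀ a b, ρ (a * b) = ρ a * ρ b := by
    intro a b
    refine endSubmonoid_intertwiner_unique hF hlin (hρ (a * b)) ?_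
    rw [Submonoid.coe_mul, Submonoid.coe_mul, End.mul_def, End.mul_def, ← Category.assoc, hρ b,
      Category.assoc, hρ a, Category.assoc]
  refine ⟨{ toFun := ρ, map_one' := hρ1, map_mul' := hρmul }, fun a b hab => ?_, hρ⟩
  haveI := hC.epi φ
  have key : φ ≫ (a.1 : A ⟶ A) = φ ≫ (b.1 : A ⟶ A) := by
    rw [hρ a, hρ b]
    exact congrArg (fun r : endSubmonoid F B => (r.1 : B ⟶ B) ≫ φ) hab
  exact Subtype.ext ((cancel_epi φ).mp key)

/-! ### Proposition 1.11 (vi) -/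

/-- **Prop. 1.11 (vi)**, monomorphisms: a pull-back morphism is a monomorphism iff its projection
is. [cite: MochizukiFrdI2008, Prop. 1.11(vi) p.37] -/
theorem mono_iff_of_isPullbackMorphism (hF : IsFrobenioid F) {A B : C} {φ : A ⟶ B}
    (hφ : IsPullbackMorphism F φ) : Mono φ ↔ Mono (Base F φ) := by
  constructor
  · intro hm
    refine ⟨fun {Z₀} g g' h => ?_⟩
    obtain ⟨W, ψ, i, -, hψb⟩ := exists_isPullbackMorphism_over hF A g
    obtain ⟨ψ', hψ', hψ'b⟩ := hφ.exists_lift (ψ ≫ φ) (i.hom ≫ g')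
      (by rw [base_comp, hψb, Category.assoc, Category.assoc, h])
    have : ψ' = ψ := (cancel_mono φ).mp hψ'
    rw [this, hψb] at hψ'b
    exact (cancel_epi i.hom).mp hψ'b
  · intro hm
    exact ⟨fun g g' h => hφ.hom_ext h ((cancel_mono (Base F φ)).mp
      (by rw [← base_comp, ← base_comp, h]))⟩

/-- **Prop. 1.11 (vi)**, fiberwise-surjective morphisms: a pull-back morphism is fiberwise
surjective iff its projection is. [cite: MochizukiFrdI2008, Prop. 1.11(vi) p.37] -/
theorem isFiberwiseSurjective_iff_of_isPullbackMorphism (hF : IsFrobenioid F) {A B : C} {φ : A ⟶ B}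
    (hφ : IsPullbackMorphism F φ) : IsFiberwiseSurjective φ ↔ IsFiberwiseSurjective (Base F φ) := by
  constructor
  · intro h Z₀ g
    obtain ⟨W, ψ, i, -, hψb⟩ := exists_isPullbackMorphism_over hF B g
    obtain ⟨W', δA, δW, hδ⟩ := h ψ
    refine ⟨baseObj F W', Base F δA, Base F δW ≫ i.hom, ?_⟩
    rw [← base_comp, hδ, base_comp, hψb, Category.assoc]
  · intro h X γ
    obtain ⟨Z₀, d₁, d₂, hd⟩ := h (Base F γ)
    obtain ⟨W, ψ, i, -, hψb⟩ := exists_isPullbackMorphism_over hF X d₂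
    obtain ⟨δ, hδ, -⟩ := hφ.exists_lift (ψ ≫ γ) (i.hom ≫ d₁)
      (by rw [base_comp, hψb, Category.assoc, Category.assoc, hd])
    exact ⟨W, δ, ψ, hδ⟩

/-- **Prop. 1.11 (vi)**, FSM-morphisms: a pull-back morphism is an FSM-morphism iff its projection
is. [cite: MochizukiFrdI2008, Prop. 1.11(vi) p.37] -/
theorem isFSM_iff_of_isPullbackMorphism (hF : IsFrobenioid F) {A B : C} {φ : A ⟶ B}
    (hφ : IsPullbackMorphism F φ) : IsFSM φ ↔ IsFSM (Base F φ) :=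
  and_congr (isFiberwiseSurjective_iff_of_isPullbackMorphism hF hφ) (mono_iff_of_isPullbackMorphism hF hφ)

/-- **Prop. 1.11 (vi)**, irreducible morphisms: a pull-back morphism is irreducible iff its
projection is (factors of a pull-back morphism are pull-back morphisms, Prop. 1.7 (v); a pull-back
morphism is an isomorphism iff its projection is, Remark 1.2.1).
[cite: MochizukiFrdI2008, Prop. 1.11(vi) p.37] -/
theorem isIrreducibleHom_iff_of_isPullbackMorphism (hF : IsFrobenioid F) {A B : C} {φ : A ⟶ B}
    (hφ : IsPullbackMorphism F φ) : IsIrreducibleHom φ ↔ IsIrreducibleHom (Base F φ) := by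
  have hiso : ∀ {X Y : C} (f : X ⟶ Y), IsPullbackMorphism F f → (IsIso f ↔ IsIso (Base F f)) :=
    fun f hf => ⟨fun _ => isBaseIso_of_isIso F f,
      fun h => (isPullbackMorphism_and_isBaseIso_iff_isIso F f).mp ⟨hf, h⟩⟩
  constructor
  · rintro ⟨hni, hfac⟩
    refine ⟨fun h => hni ((hiso φ hφ).mpr h), fun Z₀ g h hgh => ?_⟩
    -- realise `h` by a pull-back morphism `ψ : W → B` and lift `φ` along it
    obtain ⟨W, ψ, i, hψ, hψb⟩ := exists_isPullbackMorphism_over hF B h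
    obtain ⟨γ, hγ, hγb⟩ := hψ.exists_lift φ (g ≫ i.inv)
      (by rw [hψb, Category.assoc, i.inv_hom_id_assoc, hgh])
    have hγpb : IsPullbackMorphism F γ :=
      (isPullbackMorphism_factors F hF (show IsPullbackMorphism F (γ ≫ ψ) by rw [hγ]; exact hφ)).2
    rcases hfac γ ψ hγ with h1 | h2
    · left
      haveI : IsIso (Base F ψ) := (hiso ψ hψ).mp h1
      have : h = i.inv ≫ Base F ψ := by rw [hψb, i.inv_hom_id_assoc]
      rw [this]; infer_instance
    · right
      haveI : IsIso (Base F γ) := (hiso γ hγpb).mp h2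
      have : g = Base F γ ≫ i.hom := by rw [hγb, Category.assoc, i.inv_hom_id, Category.comp_id]
      rw [this]; infer_instance
  · rintro ⟨hni, hfac⟩
    refine ⟨fun h => hni ((hiso φ hφ).mp h), fun X β α h => ?_⟩
    obtain ⟨hα, hβ⟩ := isPullbackMorphism_factors F hF (show IsPullbackMorphism F (β ≫ α) by
      rw [h]; exact hφ)
    rcases hfac (Base F β) (Base F α) (by rw [← base_comp, h]) with h1 | h2
    · exact Or.inl ((hiso α hα).mpr h1)
    · exact Or.inr ((hiso β hβ).mpr h2)

end PreFrobenioid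

end Literature.AlgebraicGeometry.Frobenioids
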